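import Summits.CriticalPhenomena.SAWScalingLimit.Theses.SAWChargeContinuation
import Summits.CriticalPhenomena.SAWScalingLimit.Theorems.SAWChargeContinuationAvoidanceOfLimitSuperdomains
import Summits.CriticalPhenomena.SAWScalingLimit.Theorems.SimpleSubseqLimits.Negative.SimpleSubseqLimitsHonesty
import Literature.Probability.RandomPlanarGeometry.RestrictionHullsProofs
import Literature.Probability.RandomPlanarGeometry.RestrictionHullsRiemannProofs
import Literature.Probability.Percolation.CLE6Proofs
import Mathlib.MeasureTheory.Measure.Portmanteau

/-!
# `AvoidanceOfLimit` (stmt-CriticalPhenomena-11198, route `SAWChargeContinuation`)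

Landing target:
`Summits/CriticalPhenomena/SAWScalingLimit/Theorems/SAWChargeContinuationAvoidanceOfLimit.lean`
(`--workitem stmt-CriticalPhenomena-11198`).

**Theorem** (`avoidanceOfLimit_proof`, the route decl verbatim). Assume `SAWAvoidanceLaw`: for every
hull subdomain `D''` of a Dobrushin domain `D` the critical `δℤ²` SAW probability of the lattice
event `E_δ(D'') = {all darts are mesh edges of D'' between mesh vertices of D''}` tends to
`Φ'_{A''}(0)^{5/8}`, `A'' = cl(ℍ ∖ φ⁻¹ D'')`. Then every subsequential weak limit `μ` of the SAW laws of
`(D; a_δ, b_δ)` gives mass exactly `d^{5/8} = Φ'_A(0)^{5/8}` to `{trace ⊆ cl D'}` for every hull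
subdomain `D'` with restriction data `(φ, Φ, d)`.

**Proof** (portmanteau sandwich; no simplicity of `μ` is needed).
* `≥`: for distinct endpoints `E_δ(D') ⊆ {trace ⊆ cl D'}`, a CLOSED event, so
  `d^{5/8} = lim P_δ(E_δ(D')) ≤ limsup P_{s n}{trace ⊆ cl D'} ≤ μ{trace ⊆ cl D'}` (the laws along
  the sequence are eventually probability measures: honesty, `SimpleSubseqLimitsHonesty`).
* `≤`: with the monotone carved super-domains `D' ⊆ E_k = D ∖ T_k` of the sibling file
  `…AvoidanceOfLimitSuperdomains` (`T_k` closed, off `cl D'`, increasing, exhausting `D ∖ cl D'`),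
  `{trace ⊆ cl D'} ⊆ {trace ⊆ T_kᶜ}` (OPEN) `⊆ E_δ(E_k)` on lattice curves, so
  `μ{trace ⊆ cl D'} ≤ liminf P_{s n}(E_{s n}(E_k)) = d_k^{5/8}`, and `d_k → d`
  (`tendsto_restrictionDeriv_superdomains`: kernel convergence of the pulled-back hulls).
-/

noncomputable section

open scoped Topology NNReal ENNReal
open Filter Set Metric MeasureTheory
open Literature.Probability.RandomPlanarGeometry Literature.Probability.LatticeModels
open UpperHalfPlane (upperHalfPlaneSet isOpen_upperHalfPlaneSet)

namespace Summit.CriticalPhenomena.SAWScalingLimit.Theorems.AvoidanceOfLimit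

open Summit.CriticalPhenomena.SAWScalingLimit.Theorems.SimpleSubseqLimits.Negative
  (WeakLimitAlong eventually_isProbabilityMeasure_of_weakLimitAlong)

/-! ### Lattice events and the trace of the polyline -/

section Lattice

variable {Ω Ω' : Set ℂ} {δ : ℝ} {u v : Site 2}

/-- Every edge segment of a walk lies on the trace of its polyline. [folklore] -/
theorem segment_subset_range_toCurve {V : Type*} {G : SimpleGraph V} (f : V → ℂ) :
    ∀ {x y : V} (p : G.Walk x y), ∀ e ∈ p.darts,
      segment ℝ (f e.fst) (f e.snd) ⊆ Set.range (p.toCurve f)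
  | _, _, SimpleGraph.Walk.nil, e, he => by simp at he
  | _, _, SimpleGraph.Walk.cons h p, e, he => by
    rw [SimpleGraph.Walk.range_toCurve_cons]
    rw [SimpleGraph.Walk.darts_cons, List.mem_cons] at he
    rcases he with rfl | he
    · exact subset_union_left
    · exact (segment_subset_range_toCurve f p e he).trans subset_union_right

/-- The trace of the curve of a SAW is the trace of its polyline. [folklore] -/
theorem curve_range_eq (γ : SAW.DomainSAW Ω δ u v) :
    γ.curve.range = Set.range (γ.walk.toCurve (meshPoint δ)) := rfl

/-- **`E_δ(Ω') ⊆ {trace ⊆ cl Ω'}`** for walks between distinct endpoints: if every dart is a mesh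
edge of `Ω'` (segment in `cl Ω'`), the polyline lies in the closed set `cl Ω'`. [folklore] -/
theorem curve_mem_rangeSubset_of_darts (huv : u ≠ v) (γ : SAW.DomainSAW Ω δ u v)
    (hγ : ∀ e ∈ γ.walk.darts, (meshGraph Ω' δ).Adj e.fst e.snd ∧
      e.fst ∈ meshVertices Ω' δ ∧ e.snd ∈ meshVertices Ω' δ) :
    γ.curve ∈ CurveClass.rangeSubset (closure Ω') := by
  rw [CurveClass.mem_rangeSubset, curve_range_eq]
  have hnil : ¬ γ.walk.Nil := fun h ↦ huv h.eq
  exact SimpleGraph.Walk.range_toCurve_subset_of_not_nil hnil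
    fun e he ↦ (meshGraph_adj_iff.1 (hγ e he).1).2

/-- **`{trace ⊆ Tᶜ} ⊆ E_δ(Ω ∖ T)`** for `T` closed: every vertex of a dart of a walk of `Ω_δ` is a
mesh vertex of `Ω` on the trace, hence in `Ω ∖ T`, and every edge segment lies on the trace and
in `cl Ω`, hence in `cl Ω ∖ T ⊆ cl (Ω ∖ T)`. [folklore] -/
theorem darts_of_curve_mem_rangeSubset_compl {T : Set ℂ} (hT : IsClosed T)
    (γ : SAW.DomainSAW Ω δ u v) (hγ : γ.curve ∈ CurveClass.rangeSubset Tᶜ) :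
    ∀ e ∈ γ.walk.darts, (meshGraph (Ω \ T) δ).Adj e.fst e.snd ∧
      e.fst ∈ meshVertices (Ω \ T) δ ∧ e.snd ∈ meshVertices (Ω \ T) δ := by
  rw [CurveClass.mem_rangeSubset, curve_range_eq] at hγ
  intro e he
  have hadj : (discreteDomainGraph Ω δ).Adj e.fst e.snd := e.adj
  obtain ⟨hmesh, hfst, hsnd⟩ := discreteDomainGraph_adj_iff.1 hadj
  obtain ⟨hzd, hseg⟩ := meshGraph_adj_iff.1 hmesh
  have hfstΩ : meshPoint δ e.fst ∈ Ω := meshDomain_subset_meshVertices Ω δ hfst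
  have hsndΩ : meshPoint δ e.snd ∈ Ω := meshDomain_subset_meshVertices Ω δ hsnd
  have hfstT : meshPoint δ e.fst ∈ Tᶜ := hγ (SimpleGraph.Walk.mem_range_toCurve _ _
    (SimpleGraph.Walk.dart_fst_mem_support_of_mem_darts _ he))
  have hsndT : meshPoint δ e.snd ∈ Tᶜ := hγ (SimpleGraph.Walk.mem_range_toCurve _ _
    (SimpleGraph.Walk.dart_snd_mem_support_of_mem_darts _ he))
  refine ⟨meshGraph_adj_iff.2 ⟨hzd, fun z hz ↦ ?_⟩, ⟨hfstΩ, hfstT⟩, ⟨hsndΩ, hsndT⟩⟩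
  have hzT : z ∈ Tᶜ := hγ (segment_subset_range_toCurve (meshPoint δ) γ.walk e he hz)
  have hzΩ : z ∈ closure Ω := hseg hz
  have : z ∈ Tᶜ ∩ closure Ω := ⟨hzT, hzΩ⟩
  have h2 := hT.isOpen_compl.inter_closure this
  rwa [inter_comm, ← sdiff_eq] at h2

end Lattice

/-! ### Portmanteau along a weakly convergent sequence of SAW laws -/

section Portmanteau

variable {D : DobrushinDomain} {a b : ℝ → Site 2} {s : ℕ → ℝ} {μ : Measure (CurveClass ℂ)}

/-- Under an endpoint approximation the two lattice endpoints are eventually distinct. [folklore] -/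
theorem eventually_ne_of_isEndpointApprox (hab : SAW.IsEndpointApprox D a b) :
    ∀ᶠ δ in 𝓝[>] (0 : ℝ), a δ ≠ b δ := by
  have hne : D.pt 0 ≠ D.pt 1 := fun h ↦ absurd (D.pt_injective h) (by decide)
  obtain ⟨U, V, hU, hV, hU0, hV1, hUV⟩ := t2_separation hne
  filter_upwards [hab.tendsto_fst (hU.mem_nhds hU0), hab.tendsto_snd (hV.mem_nhds hV1)]
    with δ h0 h1 heq
  have h0' : meshPoint δ (a δ) ∈ U := h0
  have h1' : meshPoint δ (b δ) ∈ V := h1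
  rw [heq] at h0'
  exact Set.disjoint_left.1 hUV h0' h1'

/-- **Portmanteau along the sequence.** If the SAW laws along `s n` converge weakly to the
probability measure `μ`, then (the laws being eventually probability measures, honesty) for every
closed `F`, `limsup P_{s n}(curve ∈ F) ≤ μ F`, and for every open `G`,
`μ G ≤ liminf P_{s n}(curve ∈ G)`. [cite: BillingsleyCPM1999, Thm. 2.1 (portmanteau)] -/
theorem portmanteau [IsProbabilityMeasure μ] (hw : WeakLimitAlong D a b s μ) :
    (∀ F : Set (CurveClass ℂ), IsClosed F →
      limsup (fun n ↦ SAW.law D.carrier (s n) (a (s n)) (b (s n))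
        ((fun γ : SAW.DomainSAW D.carrier (s n) (a (s n)) (b (s n)) ↦ γ.curve) ⁻¹' F)) atTop ≤
        μ F) ∧
    ∀ G : Set (CurveClass ℂ), IsOpen G →
      μ G ≤ liminf (fun n ↦ SAW.law D.carrier (s n) (a (s n)) (b (s n))
        ((fun γ : SAW.DomainSAW D.carrier (s n) (a (s n)) (b (s n)) ↦ γ.curve) ⁻¹' G)) atTop := by
  classical
  have hmeas : ∀ n, Measurable
      (fun γ : SAW.DomainSAW D.carrier (s n) (a (s n)) (b (s n)) ↦ γ.curve) :=
    fun n ↦ SAW.DomainSAW.measurable_of_top _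
  let Q : ℕ → Measure (CurveClass ℂ) := fun n ↦
    (SAW.law D.carrier (s n) (a (s n)) (b (s n))).map
      fun γ : SAW.DomainSAW D.carrier (s n) (a (s n)) (b (s n)) ↦ γ.curve
  let c₀ : CurveClass ℂ := CurveClass.mk ⟨ContinuousMap.const _ 0⟩
  let Q' : ℕ → Measure (CurveClass ℂ) := fun n ↦
    if IsProbabilityMeasure (Q n) then Q n else Measure.dirac c₀
  have hQ' : ∀ n, IsProbabilityMeasure (Q' n) := fun n ↦ by
    by_cases h : IsProbabilityMeasure (Q n)
    · simp only [Q', if_pos h]; exact h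
    · simp only [Q', if_neg h]; infer_instance
  have hev : ∀ᶠ n in atTop, Q' n = Q n := by
    filter_upwards [eventually_isProbabilityMeasure_of_weakLimitAlong hw] with n hn
    haveI := hn.1
    have : IsProbabilityMeasure (Q n) := Measure.isProbabilityMeasure_map (hmeas n).aemeasurable
    simp only [Q', if_pos this]
  let P : ℕ → ProbabilityMeasure (CurveClass ℂ) := fun n ↦ ⟨Q' n, hQ' n⟩
  have hP : Tendsto P atTop (𝓝 (⟨μ, inferInstance⟩ : ProbabilityMeasure (CurveClass ℂ))) := by
    rw [ProbabilityMeasure.tendsto_iff_forall_integral_tendsto]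
    intro f
    refine (hw f).congr' ?_
    filter_upwards [hev] with n hn
    change ∫ γ, f γ.curve ∂SAW.law D.carrier (s n) (a (s n)) (b (s n)) = ∫ x, f x ∂Q' n
    rw [hn]
    exact (integral_map (hmeas n).aemeasurable f.continuous.aestronglyMeasurable).symm
  have hPQ : ∀ᶠ n in atTop, ∀ S : Set (CurveClass ℂ), MeasurableSet S →
      ((P n : ProbabilityMeasure (CurveClass ℂ)) : Measure (CurveClass ℂ)) S =
        SAW.law D.carrier (s n) (a (s n)) (b (s n))
          ((fun γ : SAW.DomainSAW D.carrier (s n) (a (s n)) (b (s n)) ↦ γ.curve) ⁻¹' S) := by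
    filter_upwards [hev] with n hn S hS
    change Q' n S = _
    rw [hn]
    exact Measure.map_apply (hmeas n) hS
  refine ⟨fun F hF ↦ ?_, fun G hG ↦ ?_⟩
  · have h := ProbabilityMeasure.limsup_measure_closed_le_of_tendsto hP hF
    refine le_trans (le_of_eq (limsup_congr ?_)) h
    filter_upwards [hPQ] with n hn
    exact (hn F hF.measurableSet).symm
  · have h := ProbabilityMeasure.le_liminf_measure_open_of_tendsto hP hG
    refine h.trans (le_of_eq (liminf_congr ?_))
    filter_upwards [hPQ] with n hn
    exact hn G hG.measurableSet

end Portmanteau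

/-! ### The theorem -/

open Summit.CriticalPhenomena.SAWScalingLimit.Theses.SAWChargeContinuation
  (SAWAvoidanceLaw AvoidanceOfLimit)

/-- **Avoidance numbers of subsequential limits** (folded form of the route decl). Under
`SAWAvoidanceLaw`, every subsequential weak limit `μ` of the critical SAW laws of `(D; a_δ, b_δ)`
satisfies `μ{trace ⊆ cl D'} = Φ'_A(0)^{5/8}` for every hull subdomain `D'` with restriction data
`(φ, Φ, d)`: portmanteau sandwich between the closed event `{trace ⊆ cl D'} ⊇ E_δ(D')` and the open
events `{trace ⊆ T_kᶜ} ⊆ E_δ(D ∖ T_k)` of the monotone carved super-domains, closed by the kernel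
continuity `Φ'_{A_k}(0) → Φ'_A(0)`. [cite: LawlerSchrammWerner2003Restriction, Lemma 3.5 (p. 12)] -/
theorem measure_rangeSubset_closure_eq (hA0 : SAWAvoidanceLaw) {D : DobrushinDomain}
    {a b : ℝ → Site 2} (hab : SAW.IsEndpointApprox D a b) {s : ℕ → ℝ}
    {μ : Measure (CurveClass ℂ)} (hs : Tendsto s atTop (𝓝[>] (0 : ℝ))) [IsProbabilityMeasure μ]
    (hw : WeakLimitAlong D a b s μ) {D' : DobrushinDomain} (hD' : D.IsHullSubdomain D')
    {φ : ConformalEquiv upperHalfPlaneSet D.carrier} (hφ : D.IsChordalUniformizing φ)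
    {Φ : ConformalEquiv (upperHalfPlaneSet \ φ.pullbackHull D') upperHalfPlaneSet} {d : ℝ}
    (hΦ : IsRestrictionMap (φ.pullbackHull D') Φ)
    (hd : HasRestrictionDeriv (φ.pullbackHull D') Φ d) :
    μ (CurveClass.rangeSubset (closure D'.carrier)) = ENNReal.ofReal (d ^ (5 / 8 : ℝ)) := by
  classical
  have hsc : ∀ D : JordanDomain, D.isSimplyConnected := JordanDomain.isSimplyConnected_holds
  obtain ⟨hclosed, hopen⟩ := portmanteau hw
  have hne : ∀ᶠ n in atTop, a (s n) ≠ b (s n) :=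
    hs.eventually (eventually_ne_of_isEndpointApprox hab)
  -- the avoidance law along the sequence, in `ℝ≥0∞`
  have hlim : ∀ {D'' : DobrushinDomain}, D.IsHullSubdomain D'' →
      ∀ {Ψ : ConformalEquiv (upperHalfPlaneSet \ φ.pullbackHull D'') upperHalfPlaneSet} {e : ℝ},
      IsRestrictionMap (φ.pullbackHull D'') Ψ → HasRestrictionDeriv (φ.pullbackHull D'') Ψ e →
      Tendsto (fun n ↦ SAW.law D.carrier (s n) (a (s n)) (b (s n))
        {γ | ∀ e ∈ γ.walk.darts, (meshGraph D''.carrier (s n)).Adj e.fst e.snd ∧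
          e.fst ∈ meshVertices D''.carrier (s n) ∧ e.snd ∈ meshVertices D''.carrier (s n)})
        atTop (𝓝 (ENNReal.ofReal (e ^ (5 / 8 : ℝ)))) := by
    intro D'' hD'' Ψ e hΨ he
    have h1 := ENNReal.tendsto_ofReal ((hA0 D D'' hD'' a b hab φ hφ Ψ e hΨ he).comp hs)
    refine h1.congr' (Eventually.of_forall fun n ↦ ?_)
    exact ENNReal.ofReal_toReal (measure_ne_top _ _)
  -- `≥`: the closed event `{trace ⊆ cl D'}` contains `E_δ(D')`
  have hlow : ENNReal.ofReal (d ^ (5 / 8 : ℝ)) ≤ μ (CurveClass.rangeSubset (closure D'.carrier)) := by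
    refine le_trans ?_ (hclosed _ (CurveClass.isClosed_rangeSubset isClosed_closure))
    rw [← (hlim hD' hΦ hd).limsup_eq]
    refine limsup_le_limsup ?_
    filter_upwards [hne] with n hn
    exact measure_mono fun γ hγ ↦ curve_mem_rangeSubset_of_darts hn γ hγ
  -- `≤`: carved super-domains
  obtain ⟨E, T, hTcl, hTD', hE, hE0, hE1, hmono, hexh⟩ :=
    exists_monotone_superdomains D D' hD'.carrier_subset hD'.pt_zero_eq hD'.pt_one_eq
  have hEn : ∀ n, D.IsHullSubdomain (E n) := fun n ↦
    isHullSubdomain_of_carrier_eq_diff hD'.pt_zero_eq hD'.pt_one_eq (hTcl n) (hTD' n) (hE n)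
      (hE0 n) (hE1 n)
  have hAn : ∀ n, IsStarHull (φ.pullbackHull (E n)) := fun n ↦
    IsStarHull.pullbackHull hsc hφ (hEn n)
  choose Φn hΦn _ using fun n ↦ IsStarHull.existsUnique_isRestrictionMap_holds (hAn n)
  choose dn _ _ hdn using fun n ↦ IsStarHull.exists_hasRestrictionDeriv_holds (hAn n) (hΦn n)
  have htend : Tendsto dn atTop (𝓝 d) :=
    tendsto_restrictionDeriv_superdomains hφ hD' hTcl hTD' hE hE0 hE1 hmono hexh hΦ hd hΦn hdn
  have hup : ∀ k, μ (CurveClass.rangeSubset (closure D'.carrier)) ≤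
      ENNReal.ofReal (dn k ^ (5 / 8 : ℝ)) := by
    intro k
    have hFG : CurveClass.rangeSubset (closure D'.carrier) ⊆ CurveClass.rangeSubset (T k)ᶜ :=
      fun c hc ↦ (CurveClass.mem_rangeSubset.1 hc).trans (hTD' k).subset_compl_left
    calc μ (CurveClass.rangeSubset (closure D'.carrier))
        ≤ μ (CurveClass.rangeSubset (T k)ᶜ) := measure_mono hFG
      _ ≤ liminf (fun n ↦ SAW.law D.carrier (s n) (a (s n)) (b (s n))
            ((fun γ : SAW.DomainSAW D.carrier (s n) (a (s n)) (b (s n)) ↦ γ.curve) ⁻¹'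
              CurveClass.rangeSubset (T k)ᶜ)) atTop :=
          hopen _ (CurveClass.isOpen_rangeSubset (hTcl k).isOpen_compl)
      _ ≤ liminf (fun n ↦ SAW.law D.carrier (s n) (a (s n)) (b (s n))
            {γ | ∀ e ∈ γ.walk.darts, (meshGraph (E k).carrier (s n)).Adj e.fst e.snd ∧
              e.fst ∈ meshVertices (E k).carrier (s n) ∧
              e.snd ∈ meshVertices (E k).carrier (s n)}) atTop := by
          refine liminf_le_liminf (Eventually.of_forall fun n ↦ measure_mono fun γ hγ ↦ ?_)
          rw [hE k]
          exact darts_of_curve_mem_rangeSubset_compl (hTcl k) γ hγ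
      _ = ENNReal.ofReal (dn k ^ (5 / 8 : ℝ)) := (hlim (hEn k) (hΦn k) (hdn k)).liminf_eq
  have htend' : Tendsto (fun k ↦ ENNReal.ofReal (dn k ^ (5 / 8 : ℝ))) atTop
      (𝓝 (ENNReal.ofReal (d ^ (5 / 8 : ℝ)))) :=
    ENNReal.tendsto_ofReal (htend.rpow_const (Or.inr (by norm_num)))
  exact le_antisymm (ge_of_tendsto' htend' hup) hlow

/-- **`AvoidanceOfLimit`** (item stmt-CriticalPhenomena-11198 of route `SAWChargeContinuation`,
verbatim): `SAWAvoidanceLaw ⇒` every subsequential weak limit `μ` of the SAW laws in `D` gives mass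
`d^{5/8}` to `{trace ⊆ cl D'}` for every hull subdomain `D'` with restriction data `(φ, Φ, d)`. The
inlined lets `hull` / `pb` of the route decl are `MarkedDomain.IsHullSubdomain` /
`ConformalEquiv.pullbackHull` by `Iff.rfl` / `rfl`. [cite: LawlerSchrammWerner2003Restriction, Lemma 3.5 (p. 12)] -/
theorem avoidanceOfLimit_proof : AvoidanceOfLimit := by
  intro hA0 D a b hab s μ hs hμ hw D' hD' φ hφ Φ d hΦ hd
  haveI := hμ
  exact measure_rangeSubset_closure_eq hA0 hab hs hw hD' hφ hΦ hd

end Summit.CriticalPhenomena.SAWScalingLimit.Theorems.AvoidanceOfLimit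

end
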